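import Summits.CriticalPhenomena.PercolationContinuityZ3.Theorems.Transplant.FKConnectivityAllQAntipodalTwoSpineParallelCore
import HarnessLib

/-!
# CONJECTURE U¹¹ (gen 11) IS A THEOREM: `FK.apUpcSplit_nonneg_of_isTTSP` — the split antipodal up-correlation functional of every
# two-terminal series–parallel network is nonnegative (`0 < q ≤ 1`)

Helper file (`--supports stmt-CriticalPhenomena-4575`), FK sub-lane `prim-bschramm-fk-2` (gen 16); builds on p205010 (kernel theorem,
internal audit signed; external expert review pending).  No named facts, no sorries, standard axioms.

**`FK.apUpcSplit_nonneg_of_isTTSP`**: for `E` two-terminal series–parallel between `s, t` (`FK.IsTTSP E s t`), two distinct edges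
`y, z ∈ E`, `0 < q ≤ 1`, and every test function `h` monotone on the sub-configurations of `E` and not reading `y, z`:
`0 ≤ apUpcSplit q E s t y z h = ∑_{γ ⊆ E, |γ ∩ {y,z}| = 1} q^{k(γ)+k(E∖γ)} (1{s↔t in γ} - 1{s↔t in E∖γ}) h(γ)`
— gen 11's Conjecture U¹¹ (memo `bschramm/FROM-fk-2-g11-ANTIPODAL-UPC.md` §3.5, FK-Q2.md §20–24), the split up-correlation inequality
for `φ_{p,q}`, `q ≤ 1`, on series–parallel graphs.  PROOF (memos g12–g16): walk up the spine of `y` in `E` (`FK.exists_spine`) to the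
first part containing `z` — the SPLIT NODE; below it the composite `M ∋ y` is two-terminal series–parallel (`Glue.isTTSP_union`); at the
node, the series cores `…TwoSpineSeriesCore` (gen 15's two-spine rule theorem + the W3 bridge) or the parallel core `…TwoSpineParallelCore`
(word duality) give `U¹¹ ≥ 0` for the node, with spines of `y` in `M` and of `z` in the part from `FK.exists_spine` in either
orientation; above it gen 14's closure lemmas `FK.IsSpine.apUpcSplit_nonneg` finish.
[cite: Grimmett2006, §1.4 eq. (1.20) (p. 15); §3.8 Thm. (3.90) (pp. 61–62); §3.9 (p. 63)]
-/

noncomputable section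

namespace Summit.CriticalPhenomena.PercolationContinuityZ3.Theorems

namespace FK

open SimpleGraph Literature.Probability.LatticeModels Literature.Probability.Percolation X2Word TwoSpine
open scoped Classical

variable {V : Type*} [Fintype V] {q : ℝ}

/-! ### The split node: series and parallel cores in either orientation of the marked edges -/

section Node

variable {psA psB : List (SpinePart V)} {A B : Finset (Sym2 V)} {V₁ V₂ : Set V} {y₁ y₂ z₁ z₂ s m t : V}

/-- Series core, marked edges oriented either way along their spines. [cite: Grimmett2006, §3.9 (p. 63)] -/
theorem apUpcSplit_series_core_nonneg' (hq0 : 0 < q) (hq1 : q ≤ 1)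
    (hA : IsSpine psA {s(y₁, y₂)} y₁ y₂ A s m ∨ IsSpine psA {s(y₁, y₂)} y₂ y₁ A s m)
    (hB : IsSpine psB {s(z₁, z₂)} z₁ z₂ B m t ∨ IsSpine psB {s(z₁, z₂)} z₂ z₁ B m t)
    (hy : y₁ ≠ y₂) (hz : z₁ ≠ z₂) (hd : Disjoint A B)
    (h₁ : ∀ e ∈ (↑A : Set (Sym2 V)), ∀ x ∈ e, x ∈ V₁) (h₂ : ∀ e ∈ (↑B : Set (Sym2 V)), ∀ x ∈ e, x ∈ V₂)
    (hS : V₁ ∩ V₂ ⊆ {m}) (hsV₂ : s ∉ V₂) (htV₁ : t ∉ V₁) (hsm : s ≠ m) (htm : t ≠ m) (hst : s ≠ t)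
    {h : Finset (Sym2 V) → ℝ} (hmono : ∀ ⦃C D : Finset (Sym2 V)⦄, C ⊆ D → D ⊆ A ∪ B → h C ≤ h D)
    (hhy : ∀ C, h (insert s(y₁, y₂) C) = h C) (hhz : ∀ C, h (insert s(z₁, z₂) C) = h C) :
    0 ≤ apUpcSplit q (A ∪ B) s t s(y₁, y₂) s(z₁, z₂) h := by
  have ey : s(y₁, y₂) = s(y₂, y₁) := Sym2.eq_swap
  have ez : s(z₁, z₂) = s(z₂, z₁) := Sym2.eq_swap
  rcases hA with hA | hA <;> rcases hB with hB | hB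
  · exact apUpcSplit_series_core_nonneg hq0 hq1 hA hB hy hz hd h₁ h₂ hS hsV₂ htV₁ hsm htm hst hmono hhy hhz
  · rw [ez] at hB hhz ⊢
    exact apUpcSplit_series_core_nonneg hq0 hq1 hA hB hy hz.symm hd h₁ h₂ hS hsV₂ htV₁ hsm htm hst hmono hhy hhz
  · rw [ey] at hA hhy ⊢
    exact apUpcSplit_series_core_nonneg hq0 hq1 hA hB hy.symm hz hd h₁ h₂ hS hsV₂ htV₁ hsm htm hst hmono hhy hhz
  · rw [ey] at hA hhy ⊢
    rw [ez] at hB hhz ⊢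
    exact apUpcSplit_series_core_nonneg hq0 hq1 hA hB hy.symm hz.symm hd h₁ h₂ hS hsV₂ htV₁ hsm htm hst hmono hhy hhz

/-- Parallel core, marked edges oriented either way along their spines. [cite: Grimmett2006, §3.9 (p. 63)] -/
theorem apUpcSplit_parallel_core_nonneg' (hq0 : 0 < q) (hq1 : q ≤ 1)
    (hA : IsSpine psA {s(y₁, y₂)} y₁ y₂ A s t ∨ IsSpine psA {s(y₁, y₂)} y₂ y₁ A s t)
    (hB : IsSpine psB {s(z₁, z₂)} z₁ z₂ B s t ∨ IsSpine psB {s(z₁, z₂)} z₂ z₁ B s t)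
    (hy : y₁ ≠ y₂) (hz : z₁ ≠ z₂) (hd : Disjoint A B)
    (h₁ : ∀ e ∈ (↑A : Set (Sym2 V)), ∀ x ∈ e, x ∈ V₁) (h₂ : ∀ e ∈ (↑B : Set (Sym2 V)), ∀ x ∈ e, x ∈ V₂)
    (hS : V₁ ∩ V₂ ⊆ {s, t}) (hst : s ≠ t)
    {h : Finset (Sym2 V) → ℝ} (hmono : ∀ ⦃C D : Finset (Sym2 V)⦄, C ⊆ D → D ⊆ A ∪ B → h C ≤ h D)
    (hhy : ∀ C, h (insert s(y₁, y₂) C) = h C) (hhz : ∀ C, h (insert s(z₁, z₂) C) = h C) :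
    0 ≤ apUpcSplit q (A ∪ B) s t s(y₁, y₂) s(z₁, z₂) h := by
  have ey : s(y₁, y₂) = s(y₂, y₁) := Sym2.eq_swap
  have ez : s(z₁, z₂) = s(z₂, z₁) := Sym2.eq_swap
  rcases hA with hA | hA <;> rcases hB with hB | hB
  · exact apUpcSplit_parallel_core_nonneg hq0 hq1 hA hB hy hz hd h₁ h₂ hS hst hmono hhy hhz
  · rw [ez] at hB hhz ⊢
    exact apUpcSplit_parallel_core_nonneg hq0 hq1 hA hB hy hz.symm hd h₁ h₂ hS hst hmono hhy hhz
  · rw [ey] at hA hhy ⊢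
    exact apUpcSplit_parallel_core_nonneg hq0 hq1 hA hB hy.symm hz hd h₁ h₂ hS hst hmono hhy hhz
  · rw [ey] at hA hhy ⊢
    rw [ez] at hB hhz ⊢
    exact apUpcSplit_parallel_core_nonneg hq0 hq1 hA hB hy.symm hz.symm hd h₁ h₂ hS hst hmono hhy hhz

end Node

/-! ### Walking up the spine of `y` to the split node -/

/-- The induction along the spine of `y`: as long as the composite `M ∋ y` (two-terminal series–parallel between `a, b`) avoids `z`,
glue the next part; the first part containing `z` is the split node (series or parallel core), the parts above it are gen 14's
closure lemmas. [cite: Grimmett2006, §3.8 Thm. (3.90) (pp. 61–62); §3.9 (p. 63)] -/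
theorem apUpcSplit_nonneg_along_spine (hq0 : 0 < q) (hq1 : q ≤ 1) {y₁ y₂ z₁ z₂ : V} (hy : y₁ ≠ y₂) (hz : z₁ ≠ z₂)
    {E : Finset (Sym2 V)} {s t : V} (hzE : s(z₁, z₂) ∈ E) :
    ∀ (ps : List (SpinePart V)) (M : Finset (Sym2 V)) (a b : V), IsTTSP M a b → s(y₁, y₂) ∈ M → s(z₁, z₂) ∉ M →
      IsSpine ps M a b E s t → ∀ h : Finset (Sym2 V) → ℝ, (∀ ⦃C D : Finset (Sym2 V)⦄, C ⊆ D → D ⊆ E → h C ≤ h D) →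
        (∀ C, h (insert s(y₁, y₂) C) = h C) → (∀ C, h (insert s(z₁, z₂) C) = h C) →
          0 ≤ apUpcSplit q E s t s(y₁, y₂) s(z₁, z₂) h := by
  intro ps
  induction ps with
  | nil =>
    intro M a b _ _ hzM hsp
    obtain ⟨rfl, -, -⟩ := hsp
    exact absurd hzE hzM
  | cons p ps ih =>
    intro M a b hM hyM hzM hsp h hmono hhy hhz
    obtain ⟨a', b', hg, hrest⟩ := hsp
    by_cases hzR : s(z₁, z₂) ∈ p.R
    · -- the split node `M ∘ p.R`
      refine hrest.apUpcSplit_nonneg hq0 (hg.ne hM.ne) (Finset.mem_union_left _ hyM) (Finset.mem_union_right _ hzR) ?_ h hmono hhy hhz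
      intro h' hmono' hhy' hhz'
      cases hg with
      | @par M R a b hR hd hV =>
        obtain ⟨psA, hA⟩ := exists_spine hM hyM
        obtain ⟨psB, hB⟩ := exists_spine hR hzR
        exact apUpcSplit_parallel_core_nonneg' hq0 hq1 hA hB hy hz hd (span_mem M) (span_mem R) (inter_span_subset_pair hV) hM.ne
          hmono' hhy' hhz'
      | @serA M R a b a' hR hd hV hb ha' =>
        -- node `R · M` read from `a'` through the cut vertex `a` to `b`: series core for `(M; b, a)` and `(R; a, a')`, terminals swapped
        obtain ⟨psA, hA⟩ := exists_spine hM.symm hyM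
        obtain ⟨psB, hB⟩ := exists_spine hR hzR
        have hS : {w : V | ∃ e ∈ M, w ∈ e} ∩ {w : V | ∃ e ∈ R, w ∈ e} ⊆ ({a} : Set V) := fun w hw => hV w hw.1 hw.2
        have hba' : b ≠ a' := ne_of_not_mem_span hb hR.right_mem
        rw [← apUpcSplit_comm_terminals]
        exact apUpcSplit_series_core_nonneg' hq0 hq1 hA hB hy hz hd (span_mem M) (span_mem R) hS
          (fun hh => by obtain ⟨e, he, hh⟩ := hh; exact hb e he hh) (fun hh => by obtain ⟨e, he, hh⟩ := hh; exact ha' e he hh)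
          hM.ne.symm hR.ne.symm hba' hmono' hhy' hhz'
      | @serB M R a b b' hR hd hV ha hb' =>
        obtain ⟨psA, hA⟩ := exists_spine hM hyM
        obtain ⟨psB, hB⟩ := exists_spine hR hzR
        have hS : {w : V | ∃ e ∈ M, w ∈ e} ∩ {w : V | ∃ e ∈ R, w ∈ e} ⊆ ({b} : Set V) := fun w hw => hV w hw.1 hw.2
        have hab' : a ≠ b' := ne_of_not_mem_span ha hR.right_mem
        exact apUpcSplit_series_core_nonneg' hq0 hq1 hA hB hy hz hd (span_mem M) (span_mem R) hS
          (fun hh => by obtain ⟨e, he, hh⟩ := hh; exact ha e he hh) (fun hh => by obtain ⟨e, he, hh⟩ := hh; exact hb' e he hh)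
          hM.ne hR.ne.symm hab' hmono' hhy' hhz'
    · exact ih (M ∪ p.R) a' b' (hg.isTTSP_union hM) (Finset.mem_union_left _ hyM)
        (fun hh => (Finset.mem_union.1 hh).elim hzM hzR) hrest h hmono hhy hhz

/-- **CONJECTURE U¹¹ (gen 11) — THEOREM.**  For every two-terminal series–parallel network `E` between `s, t`, distinct edges `y, z ∈ E`,
`0 < q ≤ 1`, and every `h` monotone on the sub-configurations of `E` not reading `y, z`:
`0 ≤ apUpcSplit q E s t y z h` — the split antipodal up-correlation inequality for `φ_{p,q}`, `q ≤ 1`, on series–parallel graphs.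
[cite: Grimmett2006, §1.4 eq. (1.20) (p. 15); §3.8 Thm. (3.90) (pp. 61–62); §3.9 (p. 63)] -/
theorem apUpcSplit_nonneg_of_isTTSP (hq0 : 0 < q) (hq1 : q ≤ 1) {E : Finset (Sym2 V)} {s t : V} (hE : IsTTSP E s t)
    {y z : Sym2 V} (hy : y ∈ E) (hz : z ∈ E) (hyz : y ≠ z)
    {h : Finset (Sym2 V) → ℝ} (hmono : ∀ ⦃C D : Finset (Sym2 V)⦄, C ⊆ D → D ⊆ E → h C ≤ h D)
    (hhy : ∀ C, h (insert y C) = h C) (hhz : ∀ C, h (insert z C) = h C) :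
    0 ≤ apUpcSplit q E s t y z h := by
  induction y using Sym2.ind with
  | h y₁ y₂ =>
    induction z using Sym2.ind with
    | h z₁ z₂ =>
      have hyne : y₁ ≠ y₂ := fun hh => hE.not_isDiag hy (Sym2.mk_isDiag_iff.2 hh)
      have hzne : z₁ ≠ z₂ := fun hh => hE.not_isDiag hz (Sym2.mk_isDiag_iff.2 hh)
      obtain ⟨ps, hsp⟩ := exists_spine hE hy
      have hzM : s(z₁, z₂) ∉ ({s(y₁, y₂)} : Finset (Sym2 V)) := fun hh => hyz (Finset.mem_singleton.1 hh).symm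
      rcases hsp with hsp | hsp
      · exact apUpcSplit_nonneg_along_spine hq0 hq1 hyne hzne hz ps {s(y₁, y₂)} y₁ y₂ (IsTTSP.edge hyne)
          (Finset.mem_singleton_self _) hzM hsp h hmono hhy hhz
      · have ey : s(y₁, y₂) = s(y₂, y₁) := Sym2.eq_swap
        rw [ey] at hsp hzM hhy ⊢
        exact apUpcSplit_nonneg_along_spine hq0 hq1 hyne.symm hzne hz ps {s(y₂, y₁)} y₂ y₁ (IsTTSP.edge hyne.symm)
          (Finset.mem_singleton_self _) hzM hsp h hmono hhy hhz

end FK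

end Summit.CriticalPhenomena.PercolationContinuityZ3.Theorems

end
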